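import Summits.QuantumAdvantage.QuantumAdvantage.Theorems.CubicForrelationNearExactIsExactFourteenLevelSixPrep
import Summits.QuantumAdvantage.QuantumAdvantage.Theorems.CubicForrelationNearExactIsExactMmFormCeilingA

/-!
# Quarter slicing of `14`-bit Boolean functions — helper lemmas (NearExactIsExact, disprover gen 23)

Support lemmas for `Negative/CaseAWindowFourteen` (THEOREM CA-W) and for the rank-`4` slicing programme of the
`n = 14` window of the crux `CubicForrelation.NearExactIsExact`.  HONEST FRAMING: elementary identities about
sums and Walsh transforms on `𝔽₂¹⁴ = 𝔽₂ × 𝔽₂ × 𝔽₂¹²` — infrastructure, NOT summit progress.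

Contents: splitting a sum / the twist character / the Walsh transform `W` along coordinate `0`
(`qs_sum_cons`, `qs_twist_cons`, `qs_W_cons`, any arity); the double split over coordinates `0, 1` of `𝔽₂¹⁴`
(`qs_sum_pt`, `qs_W_split2`: `W_g(a₀,a₁,a) = Σ_{p,q} (−1)^{a₀p + a₁q} W_{g_{pq}}(a)` with `g_{pq}(y) = g(p,q,y)`);
a quarter of a cubic is cubic (`qs_quarter_isDegLeFun`); and the coordinate cubes `{0,1} ∪ (I+2)` seen through
the slicing (`qs_card_liftI`, `qs_pt_mem_cube`, `qs_sum_cube_pt`); plus four small arithmetic / parity helpers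
(`qs_residue`, `qs_bool_of_par`, `qs_card_odd_mod_two`, `qs_indicator_sum`).  Points of `𝔽₂¹⁴` are written
`Fin.cons p (Fin.cons q a)` (`p, q` the coordinates `0, 1`, `a ∈ 𝔽₂¹²`).  All [folklore]; standard axioms only.
-/

set_option linter.dupNamespace false -- D-0017: single-problem summit ⇒ `QuantumAdvantage.QuantumAdvantage` by design

noncomputable section

namespace Summit.QuantumAdvantage.QuantumAdvantage.Theorems.NearExactIsExact.Negative.QuarterSlicingFourteen

open Finset
open Literature.Computability.QuantumComplexity
open Literature.Computability.QuantumComplexity.DerivativeWalsh (W)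
open Summit.QuantumAdvantage.QuantumAdvantage.Theorems.CubicForrelation.NearExactIsExact

/-- Splitting a sum over `Fin (k+1) → Bool` along coordinate `0`. [folklore] -/
theorem qs_sum_cons {β : Type*} [AddCommMonoid β] (k : ℕ) (h : (Fin (k + 1) → Bool) → β) :
    ∑ x, h x = ∑ p : Bool, ∑ y : Fin k → Bool, h (Fin.cons p y) := by
  rw [← Fintype.sum_equiv (Fin.consEquiv fun _ => Bool) (fun z => h (Fin.cons z.1 z.2)) h (fun _ => rfl),
    Fintype.sum_prod_type]

/-- The twist factors over coordinate `0`: `(−1)^{(p∷y)·(q∷v)} = (−1)^{pq} (−1)^{y·v}`. [folklore] -/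
theorem qs_twist_cons {k : ℕ} (p q : Bool) (y v : Fin k → Bool) :
    twist (Fin.cons p y : Fin (k + 1) → Bool) (Fin.cons q v) = signOf (p && q) * twist y v := by
  unfold twist signOf
  rw [Fin.prod_univ_succ]
  simp only [Fin.cons_zero, Fin.cons_succ]

/-- **One-coordinate split of the Walsh transform** (primal coordinate `0`, dual bit `q`):
`W_G(q ∷ v) = W_{G(0∷·)}(v) + (−1)^q · W_{G(1∷·)}(v)`. [folklore] -/
theorem qs_W_cons {k : ℕ} (G : (Fin (k + 1) → Bool) → Bool) (q : Bool) (v : Fin k → Bool) :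
    W (fun y => signOf (G y)) (Fin.cons q v) =
      W (fun y => signOf (G (Fin.cons false y))) v + signOf q * W (fun y => signOf (G (Fin.cons true y))) v := by
  have s0 : signOf false = 1 := by simp [signOf]
  have hT : ∀ p : Bool,
      (∑ y : Fin k → Bool, signOf (G (Fin.cons p y)) * twist (Fin.cons p y : Fin (k + 1) → Bool) (Fin.cons q v)) =
        signOf (p && q) * ∑ y : Fin k → Bool, signOf (G (Fin.cons p y)) * twist y v := by
    intro p
    rw [mul_sum]
    exact sum_congr rfl fun y _ => by rw [qs_twist_cons]; ring
  unfold W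
  rw [qs_sum_cons k (fun y => signOf (G y) * twist y (Fin.cons q v))]
  simp only [Fintype.sum_bool, hT, Bool.true_and, Bool.false_and, s0, one_mul]
  ring

/-- Double sum split: `Σ_{x ∈ 𝔽₂¹⁴} h(x) = Σ_{p,q} Σ_{a ∈ 𝔽₂¹²} h(p,q,a)`. [folklore] -/
theorem qs_sum_pt {β : Type*} [AddCommMonoid β] (h : (Fin (7 + 7) → Bool) → β) :
    ∑ x, h x = ∑ p : Bool, ∑ q : Bool, ∑ a : Fin (6 + 6) → Bool,
      h (Fin.cons p (Fin.cons q a : Fin (6 + 6 + 1) → Bool) : Fin (7 + 7) → Bool) := by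
  have e1 : ∑ x, h x = ∑ p : Bool, ∑ y : Fin 13 → Bool, h (Fin.cons p y) := qs_sum_cons 13 h
  rw [e1]
  refine Fintype.sum_congr _ _ fun p => ?_
  exact qs_sum_cons 12 (fun y : Fin 13 → Bool => h (Fin.cons p y))

/-- A quarter of a cubic is cubic. [folklore] -/
theorem qs_quarter_isDegLeFun (g : (Fin (7 + 7) → Bool) → Bool) (hg : IsDegLeFun 3 g) (p q : Bool) :
    IsDegLeFun 3 (fun y : Fin (6 + 6) → Bool => g (Fin.cons p (Fin.cons q y : Fin (6 + 6 + 1) → Bool) : Fin (7 + 7) → Bool)) := by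
  refine fc_isDegLeFun_comp (D := 1) hg
    (fun y : Fin (6 + 6) → Bool => (Fin.cons p (Fin.cons q y : Fin (6 + 6 + 1) → Bool) : Fin (7 + 7) → Bool)) (fun v => ?_)
    (by norm_num)
  refine Fin.cases ?_ (fun v' => ?_) v
  · exact isDegLeFun_const 1 p
  · refine Fin.cases ?_ (fun j => ?_) v'
    · exact isDegLeFun_const 1 q
    · exact isDegLeFun_apply j le_rfl

/-- **Double split of the Walsh transform**: with `s₀ = (−1)^{a₀}`, `s₁ = (−1)^{a₁}`,
`W_g(a₀,a₁,a) = W_{g₀₀}(a) + s₁ W_{g₀₁}(a) + s₀ (W_{g₁₀}(a) + s₁ W_{g₁₁}(a))`. [folklore] -/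
theorem qs_W_split2 (g : (Fin (7 + 7) → Bool) → Bool) (a0 a1 : Bool) (a : Fin (6 + 6) → Bool) :
    W (fun y => signOf (g y)) (Fin.cons a0 (Fin.cons a1 a : Fin (6 + 6 + 1) → Bool) : Fin (7 + 7) → Bool) =
      W (fun y => signOf (g (Fin.cons false (Fin.cons false y : Fin (6 + 6 + 1) → Bool) : Fin (7 + 7) → Bool))) a +
        signOf a1 * W (fun y => signOf (g (Fin.cons false (Fin.cons true y : Fin (6 + 6 + 1) → Bool) : Fin (7 + 7) → Bool))) a +
        signOf a0 * (W (fun y => signOf (g (Fin.cons true (Fin.cons false y : Fin (6 + 6 + 1) → Bool) : Fin (7 + 7) → Bool))) a +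
          signOf a1 * W (fun y => signOf (g (Fin.cons true (Fin.cons true y : Fin (6 + 6 + 1) → Bool) : Fin (7 + 7) → Bool))) a) := by
  have e1 : W (fun y => signOf (g y)) (Fin.cons a0 (Fin.cons a1 a : Fin (6 + 6 + 1) → Bool) : Fin (7 + 7) → Bool) =
      W (fun y : Fin 13 → Bool => signOf (g (Fin.cons false y))) (Fin.cons a1 a) +
        signOf a0 * W (fun y : Fin 13 → Bool => signOf (g (Fin.cons true y))) (Fin.cons a1 a) :=
    qs_W_cons (k := 13) g a0 (Fin.cons a1 a)
  have e2 : ∀ p : Bool, W (fun y : Fin 13 → Bool => signOf (g (Fin.cons p y))) (Fin.cons a1 a) =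
      W (fun y => signOf (g (Fin.cons p (Fin.cons false y : Fin (6 + 6 + 1) → Bool) : Fin (7 + 7) → Bool))) a +
        signOf a1 * W (fun y => signOf (g (Fin.cons p (Fin.cons true y : Fin (6 + 6 + 1) → Bool) : Fin (7 + 7) → Bool))) a :=
    fun p => qs_W_cons (k := 12) (fun y : Fin 13 → Bool => g (Fin.cons p y)) a1 a
  rw [e1, e2 false, e2 true]

/-- `#({0,1} ∪ (I+2)) = #I + 2`. [folklore] -/
theorem qs_card_liftI (I : Finset (Fin (6 + 6))) :
    #(insert (0 : Fin (7 + 7)) (insert (1 : Fin (7 + 7))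
        (Finset.image (fun j : Fin (6 + 6) => (Fin.succ (Fin.succ j) : Fin (7 + 7))) I))) = #I + 2 := by
  have hinj : Function.Injective (fun j : Fin (6 + 6) => (j.succ.succ : Fin (7 + 7))) :=
    fun i j h => Fin.succ_injective _ (Fin.succ_injective _ h)
  have h1 : (1 : Fin (7 + 7)) ∉ Finset.image (fun j : Fin (6 + 6) => (j.succ.succ : Fin (7 + 7))) I := by
    simp only [mem_image, not_exists, not_and]
    intro j _ h
    exact Fin.succ_succ_ne_one j h
  have h0 : (0 : Fin (7 + 7)) ∉ insert (1 : Fin (7 + 7))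
      (Finset.image (fun j : Fin (6 + 6) => (j.succ.succ : Fin (7 + 7))) I) := by
    simp only [mem_insert, mem_image, not_or, not_exists, not_and]
    exact ⟨by decide, fun j _ h => Fin.succ_ne_zero _ h⟩
  rw [card_insert_of_notMem h0, card_insert_of_notMem h1, card_image_of_injective _ hinj]

/-- `(p,q,a) ∈ E_{{0,1} ∪ (I+2)} ⟺ a ∈ E_I`. [folklore] -/
theorem qs_pt_mem_cube (I : Finset (Fin (6 + 6))) (p q : Bool) (a : Fin (6 + 6) → Bool) :
    (∀ i, (Fin.cons p (Fin.cons q a : Fin (6 + 6 + 1) → Bool) : Fin (7 + 7) → Bool) i = true →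
      i ∈ (insert (0 : Fin (7 + 7)) (insert (1 : Fin (7 + 7))
        (Finset.image (fun j : Fin (6 + 6) => (Fin.succ (Fin.succ j) : Fin (7 + 7))) I)))) ↔
    (∀ j, a j = true → j ∈ I) := by
  constructor
  · intro h j hj
    have h' := h j.succ.succ hj
    simp only [mem_insert, mem_image] at h'
    rcases h' with h0 | h1 | ⟨j', hj', hjj'⟩
    · exact absurd h0 (Fin.succ_ne_zero _)
    · exact absurd h1 (Fin.succ_succ_ne_one j)
    · have : j' = j := Fin.succ_injective _ (Fin.succ_injective _ hjj')
      exact this ▸ hj'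
  · intro h i
    refine Fin.cases ?_ (fun i' => ?_) i
    · intro
      exact mem_insert_self _ _
    · refine Fin.cases ?_ (fun j => ?_) i'
      · intro
        exact mem_insert_of_mem (mem_insert_self _ _)
      · intro hj
        exact mem_insert_of_mem (mem_insert_of_mem (mem_image_of_mem _ (h j hj)))

/-- Cube sums through the slicing: `Σ_{x ∈ E_{{0,1} ∪ (I+2)}} h(x) = Σ_{p,q} Σ_{a ∈ E_I} h(p,q,a)`. [folklore] -/
theorem qs_sum_cube_pt {β : Type*} [AddCommMonoid β] (I : Finset (Fin (6 + 6))) (h : (Fin (7 + 7) → Bool) → β) :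
    ∑ x ∈ {x : Fin (7 + 7) → Bool | ∀ i, x i = true →
      i ∈ (insert (0 : Fin (7 + 7)) (insert (1 : Fin (7 + 7))
        (Finset.image (fun j : Fin (6 + 6) => (Fin.succ (Fin.succ j) : Fin (7 + 7))) I)))}, h x =
      ∑ p : Bool, ∑ q : Bool, ∑ a ∈ {a : Fin (6 + 6) → Bool | ∀ j, a j = true → j ∈ I},
        h (Fin.cons p (Fin.cons q a : Fin (6 + 6 + 1) → Bool) : Fin (7 + 7) → Bool) := by
  classical
  rw [sum_filter, qs_sum_pt]
  refine Fintype.sum_congr _ _ fun p => Fintype.sum_congr _ _ fun q => ?_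
  rw [sum_filter]
  exact sum_congr rfl fun a _ => if_congr (qs_pt_mem_cube I p q a) rfl rfl

/-! ### Small arithmetic and parity helpers for THEOREM CA-W -/

/-- Case A residues: an odd `v` with `[⌊v/2⌋ odd] ≠ [⌊v/4⌋ odd]` is `≡ 3 (mod 8)` when `⌊v/2⌋` is odd and
`≡ 5 (mod 8)` otherwise. [folklore] -/
theorem qs_residue (v : ℤ) (hodd : Odd v) (hA : ¬ (Odd (v / 2) ↔ Odd (v / 2 / 2))) :
    (Odd (v / 2) → v % 8 = 3) ∧ (¬ Odd (v / 2) → v % 8 = 5) := by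
  simp only [Int.odd_iff] at hodd hA ⊢
  omega

/-- Parity bookkeeping: from an integer congruence to the Boolean digit identity. [folklore] -/
theorem qs_bool_of_par (x K N : ℤ) (l : Bool) (h : (x - K - N - (l.toNat : ℤ)) % 2 = 0) :
    decide (Odd x) = ((decide (Odd K) ^^ decide (Odd N)) ^^ l) := by
  simp only [Int.odd_iff]
  rcases Int.emod_two_eq_zero_or_one x with hx | hx <;> rcases Int.emod_two_eq_zero_or_one K with hK | hK <;>
    rcases Int.emod_two_eq_zero_or_one N with hN | hN <;> cases l <;>
    simp only [hx, hK, hN, Bool.toNat_true, Bool.toNat_false, Nat.cast_one, Nat.cast_zero] at h ⊢ <;>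
    first
    | decide
    | omega

/-- `#{a ∈ s | F a odd} ≡ Σ_{a ∈ s} F a (mod 2)`. [folklore] -/
theorem qs_card_odd_mod_two {α : Type*} (s : Finset α) (F : α → ℤ) :
    ((#(s.filter fun a => Odd (F a)) : ℕ) : ℤ) % 2 = (∑ a ∈ s, F a) % 2 := by
  classical
  rw [Finset.sum_int_mod]
  have h : ∀ a ∈ s, F a % 2 = if Odd (F a) then 1 else 0 := fun a _ => by
    by_cases ho : Odd (F a)
    · rw [if_pos ho]; exact Int.odd_iff.1 ho
    · rw [if_neg ho]; exact Int.even_iff.1 (Int.not_odd_iff_even.1 ho)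
  rw [sum_congr rfl h, Finset.sum_boole]

/-- If four integers do not sum to zero, one of them is nonzero. [folklore] -/
theorem qs_indicator_sum (x1 x2 x3 x4 : ℤ) (h : x1 + x2 + (x3 + x4) ≠ 0) :
    (1 : ℤ) ≤ (if x1 ≠ 0 then 1 else 0) + (if x2 ≠ 0 then 1 else 0) +
      ((if x3 ≠ 0 then 1 else 0) + (if x4 ≠ 0 then 1 else 0)) := by
  have nonneg : ∀ x : ℤ, (0 : ℤ) ≤ if x ≠ 0 then 1 else 0 := fun x => by split_ifs <;> norm_num
  by_cases h1 : x1 ≠ 0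
  · rw [if_pos h1]; linarith [nonneg x2, nonneg x3, nonneg x4]
  by_cases h2 : x2 ≠ 0
  · rw [if_pos h2]; linarith [nonneg x1, nonneg x3, nonneg x4]
  by_cases h3 : x3 ≠ 0
  · rw [if_pos h3]; linarith [nonneg x1, nonneg x2, nonneg x4]
  by_cases h4 : x4 ≠ 0
  · rw [if_pos h4]; linarith [nonneg x1, nonneg x2, nonneg x3]
  push Not at h1 h2 h3 h4
  exact absurd (by rw [h1, h2, h3, h4]; norm_num) h

end Summit.QuantumAdvantage.QuantumAdvantage.Theorems.NearExactIsExact.Negative.QuarterSlicingFourteen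

end
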